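import Literature.NumberTheory.EllipticCurves.ZpExtensionEisensteinReadoutOrdinaryLocalKummerStrictProofs
import Summits.BirchSwinnertonDyer.BirchSwinnertonDyer.Theorems.UniversalToricDescentKummerStrictEqMultiplicative
import HarnessLib

/-!
# (B4) at a multiplicative `v ∣ p`, KS(v)-FREE: the readout of Howard's ordinary condition lies in the local condition of
# `Sel_{p^∞}(E/K_∞)` — x9's letter with the Greenberg inclusion `strictKer ≤ localKerOver` DISCHARGED (helper, theorems only)

LEAD `bsd-wall-utd-p1` (g26), crux r205 stmt-BirchSwinnertonDyer-24737 `UniversalToricDescent.TwinAlgMuZeroAtThree`, line `beta-road` v10,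
K2 stub `stub_howardOutputsOfFamily`, D1-twin item (B4) = x10b's `Stmt.readoutSelmer` at the places above `p`: on the print frame
(`PrintX10bStubReadoutSelmer`) the `v ∣ p` step is `eisensteinTowerReadout_of_mem_localKerOver` fed by the cite-only leaf (CG) = Greenberg
LNM 1716 Prop. 2.4; x9's CG-frame re-plumbing isolated the step as `…_of_strictKer_le` with the local inclusion as hypothesis.  At a
MULTIPLICATIVE `v ∣ p` (`p` odd) that inclusion is now the THEOREM
`UniversalToricDescentKummerStrictEqMultiplicative.strictKer_kernelOfReduction_le_localKerOver_of_hasMultiplicativeReductionAt`, so the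
step holds unconditionally:

* **`eisensteinTowerReadout_of_mem_localKerOver_of_hasMultiplicativeReductionAt`** (any odd `p`, any `W/ℚ`, any number field `K`, any
  `ℤ_p`-extension `κ`); for the twin frame of crux 24737 (`Rank1Residual.Mult W′ 3`) feed `hmult` with
  `UniversalToricDescentTwinTateLineAtThree.hasMultiplicativeReductionAt_baseChange_of_mult_three` at every `w ∣ 3`.

BSD is proved for no curve by any of this; 24737 stays OPEN.
-/

set_option autoImplicit false
-- the summit and its single problem are both named `BirchSwinnertonDyer` (registry layout D-0017)
set_option linter.dupNamespace false

noncomputable section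

open scoped Classical ContRepresentation

open NumberField IsDedekindDomain Field WeierstrassCurve
open Literature.NumberTheory.EllipticCurves Literature.NumberTheory.GaloisRepresentations
open Literature.NumberTheory.GaloisRepresentations.galoisCohomology
open Literature.NumberTheory.GaloisCohomology.Howard2004
open Literature.NumberTheory.EllipticCurves.GreenbergSelmer
open IwasawaAlgebra IwasawaAlgebra.EisensteinCoeff
open Summit.BirchSwinnertonDyer.BirchSwinnertonDyer.Theorems.UniversalToricDescentKummerStrictEqMultiplicative

namespace Summit.BirchSwinnertonDyer.BirchSwinnertonDyer.Theorems.UniversalToricDescentTwinReadoutSelmerAtP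


open Literature.NumberTheory.EllipticCurves.ZpExtension (EisensteinLevel)

variable {K : Type} [Field K] [NumberField K] (W : WeierstrassCurve ℚ) [W.IsElliptic] {p : ℕ} [hp : Fact p.Prime]
  (κ : ZpExtension K p) {m : ℕ} (hm : 1 ≤ m)

variable (π : IwasawaAlgebra p ⧸ Ideal.span {(PowerSeries.X ^ m + PowerSeries.C (p : ℤ_[p]) : IwasawaAlgebra p)})
  (e : ℕ → ℕ)
  (hkill : letI := IwasawaAlgebra.isLocalRing_quotient_X_pow_add_C p hm
    ∀ k, ∀ r ∈ IsLocalRing.maximalIdeal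
      (IwasawaAlgebra p ⧸ Ideal.span {(PowerSeries.X ^ m + PowerSeries.C (p : ℤ_[p]) : IwasawaAlgebra p)}) ^ e k,
      ∀ x : EisensteinLevel p m (fun j ↦ geomTorsion (W.baseChange K) ((p : ℤ) ^ j)) (k + 1), r • x = 0)
  (hker : letI := IwasawaAlgebra.isLocalRing_quotient_X_pow_add_C p hm
    ∀ k, LinearMap.ker ((W.eisensteinTower (κ.unitTwist (-1)) hm).red k) =
      (IsLocalRing.maximalIdeal
        (IwasawaAlgebra p ⧸ Ideal.span {(PowerSeries.X ^ m + PowerSeries.C (p : ℤ_[p]) : IwasawaAlgebra p)}) ^ e k) •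
        (⊤ : Submodule (IwasawaAlgebra p ⧸ Ideal.span {(PowerSeries.X ^ m + PowerSeries.C (p : ℤ_[p]) : IwasawaAlgebra p)})
          (EisensteinLevel p m (fun j ↦ geomTorsion (W.baseChange K) ((p : ℤ) ^ j)) (k + 1 + 1))))
  (hπ : letI := IwasawaAlgebra.isLocalRing_quotient_X_pow_add_C p hm
    π ∈ IsLocalRing.maximalIdeal
      (IwasawaAlgebra p ⧸ Ideal.span {(PowerSeries.X ^ m + PowerSeries.C (p : ℤ_[p]) : IwasawaAlgebra p)}))
  (he : ∀ k, e k ≤ e (k + 1))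
  (hπX : π = Ideal.Quotient.mk _ PowerSeries.X) (hek : ∀ k, e (k + 1) - e k = m)

/-- **(B4) at a place `v ∣ p` of MULTIPLICATIVE reduction, UNCONDITIONALLY (`p` odd)** — x9's
`eisensteinTowerReadout_of_mem_localKerOver_of_strictKer_le` with its local-inclusion hypothesis `hKS`
(`strictKer ≤ localKerOver` for Greenberg's `C_v = E[p^∞] ∩ E₁(K̄_v)`, the `≥` half of KS(v) = Greenberg LNM 1716 Prop. 2.4 /
p. 76) DISCHARGED by `strictKer_kernelOfReduction_le_localKerOver_of_hasMultiplicativeReductionAt` (b2b's proved multiplicative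
Greenberg fact through the identification of the two local data): the readout of Howard's ordinary condition at `v` lies in the
local condition of `Sel_{p^∞}(E/K_∞)` at the place above `v`. [cite: GreenbergLNM1716, §2 Prop. 2.4 (pp. 74–76)]
[cite: Howard2004HeegnerKolyvagin, §3.1 and Lemma 2.2.7 / Prop. 2.2.8] -/
theorem eisensteinTowerReadout_of_mem_localKerOver_of_hasMultiplicativeReductionAt (hp2 : p ≠ 2)
    (v : HeightOneSpectrum (𝓞 K)) (hpv : ((p : ℕ) : 𝓞 K) ∈ v.asIdeal)
    (hmult : (W.baseChange K).HasMultiplicativeReductionAt v)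
    (k : ℕ)
    (c : galoisCohomology
      ((κ.unitTwist (-1)).eisensteinTwist ((W.baseChange K).torsionGaloisModule ((p : ℤ) ^ (k + 1))) hm (k + 1)) 1)
    (hc : galoisCohomology.localization
        ((κ.unitTwist (-1)).eisensteinTwist ((W.baseChange K).torsionGaloisModule ((p : ℤ) ^ (k + 1))) hm (k + 1))
        (Sum.inr v) 1 c ∈
      Tower.levelCondition
        ((κ.unitTwist (-1)).eisensteinLocalReduce (fun i ↦ (W.baseChange K).torsionGaloisModule ((p : ℤ) ^ i))
          (fun i ↦ (W.baseChange K).torsionGaloisModuleReduce p i) hm (Sum.inr v)) p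
        (fun j ↦ ((W.baseChange K).ordinaryFiltrationAt v
          (fun i ↦ (W.baseChange K).torsionGaloisModuleReduce p i) (fun _ _ ↦ rfl)).ordinaryCore
            (κ := κ.unitTwist (-1)) hm j) (k + 1)) :
    letI := IwasawaAlgebra.isLocalRing_quotient_X_pow_add_C p hm
    W.eisensteinTowerReadout κ hm π e hkill hker hπ he hπX hek
        (AddCommGroup.DirectLimit.of _ _ k c :
          AdicTower.H1A (W.eisensteinTower (κ.unitTwist (-1)) hm) π e hkill hker hπ he) ∈
      (W.baseChange K).localKerOver p κ.kerSubgroup (v.adicCompletion K) := by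
  haveI : (W.baseChange K).IsElliptic := by rw [WeierstrassCurve.baseChange]; infer_instance
  exact W.eisensteinTowerReadout_of_mem_localKerOver_of_strictKer_le κ hm π e hkill hker hπ he hπX hek v
    (strictKer_kernelOfReduction_le_localKerOver_of_hasMultiplicativeReductionAt (W.baseChange K) p hp2 hpv hmult
      κ.kerSubgroup) k c hc

end Summit.BirchSwinnertonDyer.BirchSwinnertonDyer.Theorems.UniversalToricDescentTwinReadoutSelmerAtP

end
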